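import Summits.CriticalPhenomena.SAWScalingLimit.Theorems.SAWDefectDecoherenceBoundaryClosureRHolomorphicWeakLimits
import HarnessLib

/-!
# Flat-arc uniqueness for weak-* limits straddling the gate
(crux `BoundaryClosureR`, stmt-CriticalPhenomena-14004, line `polygon-parity-squeeze`, stub
`stub_gateTrace`, mechanism (C); registered sub-goal `gateTrace_flatArc_eqOn`)

The analytic uniqueness step of the gate trace.  Setting: an open set `Ω` which inside the ball
`B(y, r)` is the open upper half-plane `{im z > im y}`; a functional `L` on continuous compactly
supported tests in `B(y, r)` (the weak-* limit of the normalised bulk functionals on the FULL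
gate ball, bounded on bounded continuous functions supported in `B̄(y, 3r/4)` — clause 5 of
`LocalL1.pickEngine_weakStarLimit`), which

* is represented by the (continuous) weak limit `g` on tests supported in the upper half-ball,
* vanishes on tests supported in the open lower half-ball (no lattice there), and
* pairs with `∂̄φ`, for smooth `φ` supported in the full ball, exactly as the AREA pairing of
  `∂̄φ` with a candidate `g⋆` continuous on the closed upper half-ball (this is the limit gate
  identity rewritten by Green's formula for the candidate).

CONCLUSION (`flatArc_eqOn_of_dbarPairing`): `g = g⋆` on `Ω ∩ B(y, r/4)`.

Proof ("distributional reflection"): the bounded functional `Λ' := Λ_b − ⟨·, g⋆ 1_{upper}⟩`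
kills every `∂̄φ` with `φ` supported in `B(y, 3r/4)`, so by Weyl's lemma for functionals
(`Literature.Analysis.Complex.weyl_dbar_ball_functional`) it is a HOLOMORPHIC density `G` on
`B(y, 3r/8) ⊇ B(y, r/4)`; `G` vanishes on the lower half-ball (both pieces of `Λ'` do), hence
everywhere (identity theorem), so `∫ χ g = ∫ χ g⋆` for all real smooth `χ` supported in the upper
half-ball, and `g = g⋆` there (`LocalL1.eqOn_of_integral_smul_eq`).  No lattice input; no
holomorphy of `g` or `g⋆` is needed at this stage.
-/

noncomputable section

open scoped Topology ContDiff BoundedContinuousFunction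
open Filter Set Metric MeasureTheory Complex
open Literature.Analysis.Complex (dbarAlong dbarAlong_eq_zero_of_notMem_tsupport
  weyl_dbar_ball_functional)
open Summit.CriticalPhenomena.SAWScalingLimit.Theorems.PickHalfPlane.LocalL1

namespace Summit.CriticalPhenomena.SAWScalingLimit.Theorems.PolygonParitySqueeze.GateTrace

/-- **The area pairing with a function integrable on a set is a bounded functional on bounded
continuous functions**: `f ↦ ∫_S f · w` for `w` integrable on `S`. [folklore] -/
theorem exists_pairingCLM {S : Set ℂ} {w : ℂ → ℂ} (hw : IntegrableOn w S) :
    ∃ P : (ℂ →ᵇ ℂ) →L[ℂ] ℂ, ∀ f : ℂ →ᵇ ℂ, P f = ∫ z in S, f z * w z := by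
  have hint : ∀ f : ℂ →ᵇ ℂ, Integrable (fun z => f z * w z) (volume.restrict S) := fun f =>
    hw.bdd_mul f.continuous.aestronglyMeasurable
      (Eventually.of_forall fun z => f.norm_coe_le_norm z)
  refine ⟨LinearMap.mkContinuous
    { toFun := fun f => ∫ z in S, f z * w z
      map_add' := fun f₁ f₂ => by
        simp only [BoundedContinuousFunction.coe_add, Pi.add_apply, add_mul]
        exact integral_add (hint f₁) (hint f₂)
      map_smul' := fun c f => by
        simp only [BoundedContinuousFunction.coe_smul, smul_eq_mul, mul_assoc,
          RingHom.id_apply]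
        exact integral_const_mul c _ } (∫ z in S, ‖w z‖) fun f => ?_, fun f => rfl⟩
  simp only [LinearMap.coe_mk, AddHom.coe_mk]
  have hbd : ∀ᵐ z ∂(volume.restrict S), ‖f z * w z‖ ≤ ‖f‖ * ‖w z‖ :=
    Eventually.of_forall fun z => by
      rw [norm_mul]
      exact mul_le_mul_of_nonneg_right (f.norm_coe_le_norm z) (norm_nonneg _)
  calc ‖∫ z in S, f z * w z‖ ≤ ∫ z in S, ‖f‖ * ‖w z‖ :=
        norm_integral_le_of_norm_le (hw.norm.const_mul ‖f‖) hbd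
    _ = ‖f‖ * ∫ z in S, ‖w z‖ := integral_const_mul _ _
    _ = (∫ z in S, ‖w z‖) * ‖f‖ := mul_comm _ _

/-- **Flat-arc uniqueness (registered sub-goal `gateTrace_flatArc_eqOn` of stub `stub_gateTrace`).**
Let `Ω` be open and flat in `B(y, r)` (`Ω ∩ B(y,r) = {im > im y} ∩ B(y,r)`), `g` continuous on
`Ω ∩ B(y,r)`, `g⋆` continuous on the closed upper half-ball `{im ≥ im y} ∩ B(y,r)`, and `L` a
functional on `C(ℂ, ℂ)` that is bounded on bounded continuous functions supported in
`B̄(y, 3r/4)`, represented by `g` on tests supported in `Ω ∩ B(y,r)`, zero on tests supported in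
the open lower half-ball, and such that `L(∂̄φ) = ∫_{im > im y} ∂̄φ · g⋆ dA` for every smooth `φ`
supported in `B(y,r)`.  Then `g = g⋆` on `Ω ∩ B(y, r/4)`.  (Weyl's lemma for the functional
`Λ_b − ⟨·, g⋆ 1_{upper}⟩`, identity theorem from the lower half-ball, fundamental lemma of the
calculus of variations.) [folklore] -/
theorem flatArc_eqOn_of_dbarPairing {Ω : Set ℂ} {y : ℂ} {r : ℝ} (hr : 0 < r)
    (hflat : Ω ∩ ball y r = {z : ℂ | y.im < z.im} ∩ ball y r)
    {g gs : ℂ → ℂ} (hg : ContinuousOn g (Ω ∩ ball y r))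
    (hgsc : ContinuousOn gs ({z : ℂ | y.im ≤ z.im} ∩ ball y r))
    {L : C(ℂ, ℂ) → ℂ}
    (hrep : ∃ Λb : (ℂ →ᵇ ℂ) →L[ℂ] ℂ, ∀ f : ℂ →ᵇ ℂ,
      tsupport f ⊆ closedBall y (3 * (r / 4)) → Λb f = L f.toContinuousMap)
    (hLg : ∀ ψ : C(ℂ, ℂ), HasCompactSupport ψ → tsupport ψ ⊆ Ω ∩ ball y r →
      L ψ = ∫ z, ψ z * g z)
    (hL0 : ∀ ψ : C(ℂ, ℂ), HasCompactSupport ψ → tsupport ψ ⊆ {z : ℂ | z.im < y.im} ∩ ball y r →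
      L ψ = 0)
    (hLgate : ∀ φ : ℂ → ℂ, ContDiff ℝ ∞ φ → HasCompactSupport φ → tsupport φ ⊆ ball y r →
      ∀ Φ : C(ℂ, ℂ), (⇑Φ = dbarAlong 1 φ) →
        L Φ = ∫ z in {z : ℂ | y.im < z.im}, dbarAlong 1 φ z * gs z) :
    EqOn g gs (Ω ∩ ball y (r / 4)) := by
  set R : ℝ := r / 4 with hRdef
  have hR : 0 < R := by positivity
  have h3R : 3 * R < r := by rw [hRdef]; linarith
  obtain ⟨Λb, hΛb⟩ := hrep
  ---------------------------------------------------------------- the pairing with `g⋆ 1_{upper}`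
  set S : Set ℂ := {z : ℂ | y.im < z.im} ∩ closedBall y (3 * R) with hSdef
  have hSm : MeasurableSet S :=
    (measurableSet_lt measurable_const Complex.measurable_im).inter measurableSet_closedBall
  have hgsS : IntegrableOn gs S := by
    have hK : IsCompact ({z : ℂ | y.im ≤ z.im} ∩ closedBall y (3 * R)) :=
      (isCompact_closedBall y (3 * R)).inter_left
        (isClosed_le continuous_const Complex.continuous_im)
    refine (hgsc.mono ?_).integrableOn_compact hK |>.mono_set ?_
    · exact inter_subset_inter_right _ (closedBall_subset_ball h3R)
    · exact inter_subset_inter_left _ (setOf_subset_setOf.2 fun z hz => le_of_lt hz)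
  obtain ⟨P, hP⟩ := exists_pairingCLM hgsS
  ---------------------------------------------------------------- `Λ' := Λb - P` kills `∂̄φ`
  have hyp : ∀ φ : ℂ → ℂ, ContDiff ℝ ∞ φ → HasCompactSupport φ →
      tsupport φ ⊆ ball y (3 * R) → ∀ Φ : ℂ →ᵇ ℂ, (⇑Φ = dbarAlong 1 φ) → (Λb - P) Φ = 0 := by
    intro φ hφ hφc hφB Φ hΦ
    have htsφ : tsupport (dbarAlong 1 φ) ⊆ tsupport φ := by
      refine closure_minimal ?_ (isClosed_tsupport φ)
      intro z hz
      by_contra hzφ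
      exact hz (dbarAlong_eq_zero_of_notMem_tsupport hzφ)
    have hts : tsupport (Φ : ℂ → ℂ) ⊆ closedBall y (3 * R) := by
      rw [hΦ]; exact htsφ.trans (hφB.trans ball_subset_closedBall)
    rw [show (Λb - P) Φ = Λb Φ - P Φ from rfl, hΛb Φ hts,
      hLgate φ hφ hφc (hφB.trans (ball_subset_ball h3R.le)) Φ.toContinuousMap hΦ, hP Φ, sub_eq_zero]
    -- `∫_{upper} ∂̄φ g⋆ = ∫_S ∂̄φ g⋆`: the integrand vanishes off the closed ball
    have h1 : ∫ z in {z : ℂ | y.im < z.im}, dbarAlong 1 φ z * gs z =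
        ∫ z in S, dbarAlong 1 φ z * gs z := by
      refine setIntegral_eq_of_subset_of_forall_sdiff_eq_zero (s := S)
        (measurableSet_lt measurable_const Complex.measurable_im) inter_subset_left ?_
      rintro z ⟨hz, hzS⟩
      have hzB : z ∉ closedBall y (3 * R) := fun h => hzS ⟨hz, h⟩
      have : dbarAlong 1 φ z = 0 := by
        refine image_eq_zero_of_notMem_tsupport fun h => hzB ?_
        exact ball_subset_closedBall (hφB (htsφ h))
      rw [this, zero_mul]
    rw [h1]
    exact setIntegral_congr_fun hSm fun z _ => by rw [hΦ]
  ---------------------------------------------------------------- Weyl: `Λ' = ∫ · G`, `G` holomorphic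
  obtain ⟨G, hG, hGrep⟩ := weyl_dbar_ball_functional (Λb - P) hR hyp
  -- evaluation of `Λ'` at a real smooth test `χ` supported in `ball y R`
  have hΛ'χ : ∀ χ : ℂ → ℝ, ContDiff ℝ ∞ χ → HasCompactSupport χ → tsupport χ ⊆ ball y R →
      ∃ Φ : ℂ →ᵇ ℂ, (⇑Φ = fun z => (χ z : ℂ)) ∧
        (Λb - P) Φ = ∫ z, (χ z : ℂ) * G z ∧
        (Λb - P) Φ = L Φ.toContinuousMap - ∫ z in S, (χ z : ℂ) * gs z := by
    intro χ hχ hχc hχB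
    have hφ : ContDiff ℝ ∞ (fun z => (χ z : ℂ)) := ofRealCLM.contDiff.comp hχ
    have hφc : HasCompactSupport (fun z => (χ z : ℂ)) := hχc.comp_left Complex.ofReal_zero
    have hφt : tsupport (fun z => (χ z : ℂ)) ⊆ tsupport χ :=
      tsupport_comp_subset Complex.ofReal_zero χ
    obtain ⟨Cφ, hCφ⟩ := hφ.continuous.bounded_above_of_compact_support hφc
    set Φ : ℂ →ᵇ ℂ := BoundedContinuousFunction.ofNormedAddCommGroup _ hφ.continuous Cφ hCφ
    have hΦ : (⇑Φ = fun z => (χ z : ℂ)) := rfl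
    have hts : tsupport (Φ : ℂ → ℂ) ⊆ closedBall y (3 * R) := by
      rw [hΦ]
      exact hφt.trans (hχB.trans (ball_subset_closedBall.trans
        (closedBall_subset_closedBall (by linarith))))
    refine ⟨Φ, hΦ, hGrep _ hφ hφc (hφt.trans hχB) Φ hΦ, ?_⟩
    rw [show (Λb - P) Φ = Λb Φ - P Φ from rfl, hΛb Φ hts, hP Φ, hΦ]
  ---------------------------------------------------------------- `G = 0` on the lower half-ball
  have hlow : EqOn G 0 ({z : ℂ | z.im < y.im} ∩ ball y R) := by
    have hV : IsOpen ({z : ℂ | z.im < y.im} ∩ ball y R) :=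
      (isOpen_lt Complex.continuous_im continuous_const).inter isOpen_ball
    refine eqOn_of_integral_smul_eq hV ?_ continuousOn_const ?_
    · exact hG.continuousOn.mono (inter_subset_right.trans (ball_subset_ball (by linarith)))
    · intro χ hχ hχc hχV
      obtain ⟨Φ, hΦ, h1, h2⟩ := hΛ'χ χ hχ hχc (hχV.trans inter_subset_right)
      have hL : L Φ.toContinuousMap = 0 := by
        refine hL0 _ ?_ ?_
        · show HasCompactSupport (⇑Φ); rw [hΦ]; exact hχc.comp_left Complex.ofReal_zero
        · show tsupport (⇑Φ) ⊆ _; rw [hΦ]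
          exact (tsupport_comp_subset Complex.ofReal_zero χ).trans
            (hχV.trans (inter_subset_inter_right _ (ball_subset_ball (by linarith))))
      have hPχ : ∫ z in S, (χ z : ℂ) * gs z = 0 := by
        refine setIntegral_eq_zero_of_forall_eq_zero fun z hz => ?_
        have hzχ : z ∉ tsupport χ := fun h => by
          have h1 : z.im < y.im := (hχV h).1
          have h2 : y.im < z.im := hz.1
          exact lt_asymm h1 h2
        rw [image_eq_zero_of_notMem_tsupport hzχ, Complex.ofReal_zero, zero_mul]
      rw [← h1, h2, hL, hPχ, sub_zero]
      simp
  ---------------------------------------------------------------- identity theorem: `G ≡ 0`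
  have hG0 : EqOn G 0 (ball y (3 * R / 2)) := by
    have hy₁ : y - ((R / 2 : ℝ) : ℂ) * I ∈ {z : ℂ | z.im < y.im} ∩ ball y R := by
      constructor
      · show (y - ((R / 2 : ℝ) : ℂ) * I).im < y.im
        simp; linarith
      · rw [mem_ball, dist_eq_norm, sub_sub_cancel_left, norm_neg, norm_mul, Complex.norm_I,
          mul_one, Complex.norm_real, Real.norm_eq_abs, abs_of_pos (by positivity)]
        linarith
    have hev : G =ᶠ[𝓝 (y - ((R / 2 : ℝ) : ℂ) * I)] 0 :=
      eventuallyEq_of_mem (((isOpen_lt Complex.continuous_im continuous_const).inter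
        isOpen_ball).mem_nhds hy₁) hlow
    exact (hG.analyticOnNhd isOpen_ball).eqOn_zero_of_preconnected_of_eventuallyEq_zero
      (convex_ball y _).isPreconnected (ball_subset_ball (by linarith) hy₁.2) hev
  ---------------------------------------------------------------- `g = g⋆` on the upper half-ball
  have hflatR : Ω ∩ ball y R = {z : ℂ | y.im < z.im} ∩ ball y R := by
    have hsub : ball y R ⊆ ball y r := ball_subset_ball (by linarith)
    rw [← inter_eq_self_of_subset_right hsub, ← inter_assoc, hflat, inter_assoc]
  have hup : EqOn g gs ({z : ℂ | y.im < z.im} ∩ ball y R) := by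
    have hV : IsOpen ({z : ℂ | y.im < z.im} ∩ ball y R) :=
      (isOpen_lt continuous_const Complex.continuous_im).inter isOpen_ball
    have hVΩ : {z : ℂ | y.im < z.im} ∩ ball y R ⊆ Ω ∩ ball y r := by
      rw [← hflatR]; exact inter_subset_inter_right _ (ball_subset_ball (by linarith))
    refine eqOn_of_integral_smul_eq hV (hg.mono hVΩ) ?_ ?_
    · exact hgsc.mono (inter_subset_inter (setOf_subset_setOf.2 fun z hz => le_of_lt hz)
        (ball_subset_ball (by linarith)))
    · intro χ hχ hχc hχV
      obtain ⟨Φ, hΦ, h1, h2⟩ := hΛ'χ χ hχ hχc (hχV.trans inter_subset_right)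
      have hχt : tsupport (fun z => (χ z : ℂ)) ⊆ tsupport χ :=
        tsupport_comp_subset Complex.ofReal_zero χ
      have hL : L Φ.toContinuousMap = ∫ z, (χ z : ℂ) * g z := by
        have key := hLg Φ.toContinuousMap
          (by show HasCompactSupport (⇑Φ); rw [hΦ]; exact hχc.comp_left Complex.ofReal_zero)
          (by show tsupport (⇑Φ) ⊆ _; rw [hΦ]; exact hχt.trans (hχV.trans hVΩ))
        rw [key]
        exact integral_congr_ae (Eventually.of_forall fun z => by
          show Φ.toContinuousMap z * g z = (χ z : ℂ) * g z
          rw [show Φ.toContinuousMap z = Φ z from rfl, hΦ])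
      -- `∫ χ G = 0`
      have hχG : ∫ z, (χ z : ℂ) * G z = 0 := by
        refine integral_eq_zero_of_ae (Eventually.of_forall fun z => ?_)
        by_cases hz : z ∈ tsupport χ
        · show (χ z : ℂ) * G z = 0
          rw [hG0 (ball_subset_ball (by linarith) (hχV hz).2), Pi.zero_apply, mul_zero]
        · show (χ z : ℂ) * G z = 0
          rw [image_eq_zero_of_notMem_tsupport hz, Complex.ofReal_zero, zero_mul]
      -- `∫_S χ g⋆ = ∫ χ g⋆`
      have hPχ : ∫ z in S, (χ z : ℂ) * gs z = ∫ z, (χ z : ℂ) * gs z := by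
        refine setIntegral_eq_integral_of_forall_compl_eq_zero fun z hz => ?_
        have hzχ : z ∉ tsupport χ := fun h => hz ⟨(hχV h).1,
          ball_subset_closedBall (ball_subset_ball (by linarith) (hχV h).2)⟩
        rw [image_eq_zero_of_notMem_tsupport hzχ, Complex.ofReal_zero, zero_mul]
      have := h1.symm.trans h2
      rw [hχG, hL, hPχ] at this
      exact (sub_eq_zero.1 this.symm)
  rwa [hflatR]

/-- **Registered sub-goal `gateTrace_flatArc_eqOn`** (crux item stmt-CriticalPhenomena-14004, line
`polygon-parity-squeeze`, stub `stub_gateTrace`, mechanism (C), flat-arc uniqueness): registry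
form (one `∀`-term) of `flatArc_eqOn_of_dbarPairing`. [folklore] -/
theorem gateTrace_flatArc_eqOn : ∀ (Ω : Set ℂ) (y : ℂ) (r : ℝ), 0 < r → Ω ∩ Metric.ball y r = {z : ℂ | y.im < z.im} ∩ Metric.ball y r → ∀ (g gs : ℂ → ℂ), ContinuousOn g (Ω ∩ Metric.ball y r) → ContinuousOn gs ({z : ℂ | y.im ≤ z.im} ∩ Metric.ball y r) → ∀ (L : C(ℂ, ℂ) → ℂ), (∃ Λb : BoundedContinuousFunction ℂ ℂ →L[ℂ] ℂ, ∀ f : BoundedContinuousFunction ℂ ℂ, tsupport f ⊆ Metric.closedBall y (3 * (r / 4)) → Λb f = L f.toContinuousMap) → (∀ ψ : C(ℂ, ℂ), HasCompactSupport ψ → tsupport ψ ⊆ Ω ∩ Metric.ball y r → L ψ = ∫ z, ψ z * g z) → (∀ ψ : C(ℂ, ℂ), HasCompactSupport ψ → tsupport ψ ⊆ {z : ℂ | z.im < y.im} ∩ Metric.ball y r → L ψ = 0) → (∀ φ : ℂ → ℂ, ContDiff ℝ ∞ φ → HasCompactSupport φ → tsupport φ ⊆ Metric.ball y r → ∀ Φ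 : C(ℂ, ℂ), (⇑Φ = Literature.Analysis.Complex.dbarAlong 1 φ) → L Φ = ∫ z in {z : ℂ | y.im < z.im}, Literature.Analysis.Complex.dbarAlong 1 φ z * gs z) → Set.EqOn g gs (Ω ∩ Metric.ball y (r / 4)) :=
  fun _ _ _ hr hflat _ _ hg hgsc _ hrep hLg hL0 hLgate =>
    flatArc_eqOn_of_dbarPairing hr hflat hg hgsc hrep hLg hL0 hLgate

end Summit.CriticalPhenomena.SAWScalingLimit.Theorems.PolygonParitySqueeze.GateTrace

end
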